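import Summits.CriticalPhenomena.PercolationContinuityZ3.Theorems.PercNearOneGluingNoHeavyQuantSliceTwoRowRates
import Summits.CriticalPhenomena.PercolationContinuityZ3.Theorems.PercNearOneGluingNoHeavyQuantSliceDomination
import Summits.CriticalPhenomena.PercolationContinuityZ3.Theorems.PercNearOneGluingNoHeavyQuantLawDecUsageMonge
import HarnessLib

/-!
# QUANT lane R8, T-DEC: bookkeeping for the single-low slice theorem — the slice's low rows, the giant parts, band self-financing
# (LEAD-NOTES-G22 N48 (3))

builds on p205010 (kernel theorem, internal audit signed; external expert review pending)

Support file (`--supports stmt-CriticalPhenomena-4575`), QUANT lane typer seat prim-quant-stmt (gen 23), rung R8 of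
`run/shared/lean/prim/quant/LADDER.md`.  Theorems only; standard axioms, no sorries.  Pieces of the witness of `…QuantSliceSingleLow`:
* `slice_lowRow_of_singleLow` — for a single-low law (only low `l` at `(T, j′)`), the slice's mass at a position `p ≤ j′` that is low at
  `T′ = T + ag` is `(1−g)ν p·[T ≤ 2p]` (band part) `+ (1−g)ν l·[p = l] + g·ν l·[p = l + a]`;
* `sum_range_extend_ite`, `sum_giantParts` — the giant parts `(1−g)ν h·[h > j′] + g·ν(h−a)·[a ≤ h, h−a > λ]` of the slice sum to
  `(1−g)·Σ_{j′<h≤M} ν h + g·Σ_{λ<k≤M} ν k` (census-2's `sum_weight_shift`);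
* `band_usage_le` — usage form of lead g22's `band_vertical_selfFinancing` / `gate_div_le`: `usage x T′ j′ w (w+a)·((1−g)ν_w) ≤ g·ν_w`
  for a band position `w` (`T ≤ 2w`), mid or giant copy alike, `0 < x ≤ g ≤ 1`.

[this work]; `…QuantSliceClosure` (`slice`), `…QuantSliceTwoRowRates` (lead g22), `…QuantSliceDomination` (census-2 g54).  Nothing here is
cited as a published result.  The gluing rows served [cite: KozmaNitzan2024, Conjecture 3 (p. 15)]; product measure
[cite: Grimmett1999, §1.3 p. 10].
-/

noncomputable section

namespace Summit.CriticalPhenomena.PercolationContinuityZ3.Theorems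

namespace Quant

open Finset

namespace LawDec

/-! ### Bookkeeping for the single-low slice -/

/-- **the low rows of the slice of a single-low law**: for a position `p ≤ j′` that is low at the raised target (`2p < T + ag`), the
slice's mass at `p` is the band part `(1−g)ν p·[T ≤ 2p]`, plus `(1−g)ν l` at `p = l`, plus `g·ν l` at `p = l + a`. [this work] -/
theorem slice_lowRow_of_singleLow (T g : ℝ) (j' l a : ℕ) (ν : ℕ → ℝ) (hg1 : g ≤ 1) (ha : 1 ≤ a)
    (hlow : 2 * (l : ℝ) < T) (hsingle : ∀ k, k ≤ j' → 2 * (k : ℝ) < T → k ≠ l → ν k = 0)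
    (p : ℕ) (hpj : p ≤ j') (hplow : 2 * (p : ℝ) < T + (a : ℝ) * g) :
    slice ν a g p = (if T ≤ 2 * (p : ℝ) then (1 - g) * ν p else 0)
      + (if p = l then (1 - g) * ν l else 0) + (if p = l + a then g * ν l else 0) := by
  have hag : (a : ℝ) * g ≤ a := by
    have := mul_le_mul_of_nonneg_left hg1 (Nat.cast_nonneg a); linarith
  unfold slice
  -- the shifted part: ν (p − a) vanishes unless p = l + a
  have hshift : (if a ≤ p then ν (p - a) else 0) = (if p = l + a then ν l else 0) := by
    by_cases hap : a ≤ p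
    · rw [if_pos hap]
      by_cases hpl : p = l + a
      · rw [if_pos hpl, hpl, Nat.add_sub_cancel]
      · rw [if_neg hpl]
        apply hsingle (p - a) (by omega)
        · have : ((p - a : ℕ) : ℝ) = (p : ℝ) - a := by push_cast [Nat.cast_sub hap]; ring
          rw [this]; linarith
        · omega
    · rw [if_neg hap, if_neg (by omega)]
  rw [hshift]
  -- the unshifted part: ν p vanishes unless p is a band position or p = l
  by_cases hpl : p = l
  · subst hpl
    have hne : ¬ (p = p + a) := by omega
    rw [if_neg (by linarith : ¬ (T ≤ 2 * (p : ℝ))), if_pos rfl, if_neg hne, if_neg hne]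
    ring
  · rw [if_neg hpl]
    by_cases hband : T ≤ 2 * (p : ℝ)
    · rw [if_pos hband]; split_ifs <;> ring
    · rw [if_neg hband, hsingle p hpj (not_le.1 hband) hpl]
      split_ifs <;> ring

/-- sums of a law vanish above its top: extending the range does not change indicator sums of `ν`. -/
theorem sum_range_extend_ite (ν : ℕ → ℝ) (M a : ℕ) (hνM : ∀ k, M < k → ν k = 0) (c : ℕ → ℝ) (P : ℕ → Prop)
    [DecidablePred P] :
    ∑ h ∈ Finset.range (M + a + 1), (if P h then c h * ν h else 0) = ∑ h ∈ Finset.range (M + 1), (if P h then c h * ν h else 0) := by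
  rw [Finset.range_eq_Ico, Finset.range_eq_Ico,
    ← Finset.sum_Ico_consecutive _ (Nat.zero_le (M + 1)) (by omega : M + 1 ≤ M + a + 1)]
  have hz : ∑ h ∈ Finset.Ico (M + 1) (M + a + 1), (if P h then c h * ν h else 0) = 0 := by
    refine Finset.sum_eq_zero fun h hh => ?_
    rw [Finset.mem_Ico] at hh
    rw [hνM h (by omega)]; simp
  rw [hz, add_zero]

/-- **the giant budget as a sum over the slice's giant parts**: `Σ_{h ≤ M+a} [(1−g)ν h·[j′ < h] + g·ν(h−a)·[a ≤ h, λ < h−a]]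
= (1−g)·Σ_{j′<h≤M} ν h + g·Σ_{λ<k≤M} ν k`. [this work] -/
theorem sum_giantParts (ν : ℕ → ℝ) (g : ℝ) (j' M a lam : ℕ) (hνM : ∀ k, M < k → ν k = 0) :
    ∑ h ∈ Finset.range (M + a + 1), ((1 - g) * (if j' + 1 ≤ h then ν h else 0)
        + g * (if a ≤ h ∧ lam + 1 ≤ h - a then ν (h - a) else 0))
      = (1 - g) * ∑ h ∈ Finset.Ico (j' + 1) (M + 1), ν h + g * ∑ k ∈ Finset.Ico (lam + 1) (M + 1), ν k := by
  rw [Finset.sum_add_distrib, ← Finset.mul_sum, ← Finset.mul_sum]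
  congr 1
  · congr 1
    have h1 := sum_range_extend_ite ν M a hνM (fun _ => 1) (fun h => j' + 1 ≤ h)
    simp only [one_mul] at h1
    rw [h1, ← Finset.sum_filter]
    congr 1
    ext h
    simp only [Finset.mem_filter, Finset.mem_range, Finset.mem_Ico]
    omega
  · congr 1
    have e : ∀ h, (if a ≤ h ∧ lam + 1 ≤ h - a then ν (h - a) else 0)
        = (if lam + 1 ≤ h - a then (1:ℝ) else 0) * (if a ≤ h then ν (h - a) else 0) := by
      intro h
      by_cases h1 : a ≤ h
      · by_cases h2 : lam + 1 ≤ h - a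
        · rw [if_pos ⟨h1, h2⟩, if_pos h2, if_pos h1, one_mul]
        · rw [if_neg (fun hh => h2 hh.2), if_neg h2, zero_mul]
      · rw [if_neg (fun hh => h1 hh.1), if_neg h1, mul_zero]
    simp only [e]
    rw [sum_weight_shift ν (fun h => if lam + 1 ≤ h - a then (1:ℝ) else 0) M a]
    have e2 : ∀ k, (if lam + 1 ≤ k + a - a then (1:ℝ) else 0) * ν k = (if lam + 1 ≤ k then ν k else 0) := by
      intro k; rw [Nat.add_sub_cancel]; split_ifs <;> ring
    simp only [e2]
    rw [← Finset.sum_filter]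
    congr 1
    ext k
    simp only [Finset.mem_filter, Finset.mem_range, Finset.mem_Ico]
    omega

/-- **band positions are self-financing, usage form**: `T ≤ 2w`, `0 < x ≤ g ≤ 1`, `a ≥ 1`, `ν_w ≥ 0` ⟹
`usage x (T+ag) j′ w (w+a) · ((1−g)·ν_w) ≤ g·ν_w` (mid or giant copy alike; lead g22's `gate_div_le` / `pairGate_vertical_le`). [this work] -/
theorem band_usage_le (x T g : ℝ) (j' w a : ℕ) (νw : ℝ) (hν : 0 ≤ νw) (hx0 : 0 < x) (hxg : x ≤ g) (hg1 : g ≤ 1) (ha : 1 ≤ a)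
    (hband : T ≤ 2 * (w : ℝ)) :
    usage x (T + (a : ℝ) * g) j' w (w + a) * ((1 - g) * νw) ≤ g * νw := by
  rcases hg1.lt_or_eq with hg1' | hg1'
  · have hu : (1 - g) * usage x (T + (a : ℝ) * g) j' w (w + a) ≤ g := by
      by_cases hgi : j' + 1 ≤ w + a
      · rw [usage_giant_eq x (T + (a : ℝ) * g) j' w (w + a) hgi]
        exact gate_div_le x g hxg hg1'
      · simp only [usage, gateOf, if_neg hgi]
        exact band_vertical_selfFinancing x T g w a hx0.le hxg hg1' ha hband
    have := mul_le_mul_of_nonneg_right hu hν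
    linarith [this]
  · subst hg1'
    simp only [sub_self, zero_mul, mul_zero, one_mul]
    exact hν

end LawDec

end Quant

end Summit.CriticalPhenomena.PercolationContinuityZ3.Theorems
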